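import Literature.NumberTheory.Sieve.LinearFormsRoughTupleBound
import HarnessLib

/-!
# Route `LeeYangFibres`, crux `AbsoluteUpgrade` (stmt-Parity-14116), line `nlc-cells-absolute-clip`:
# helper file 9 for the stub `stub_singlesDecay` — the thresholds in `N`

Elementary "for all large `N`" statements used to choose `N₀` in the proof of `SinglesDecay`:

* `eventually_basic` — `N ≥ 16` and `log N ≥ 1`;
* `eventually_ge_real`, `eventually_rpow_ge` — `N ≥ c`, `N^e ≥ c` (`e > 0`);
* `eventually_level` — `N^{1/17} + 1 ≤ N^{1/8}` (the sifting level `z ≤ 2N^{1/u}`, `u ≥ 17`, is below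
  the level of distribution `D = N^{1/8}`);
* `eventually_quarter` — `L N^{1/8} ≤ (2LN)^{1/4}` (the moduli `|a_i| d`, `d ≤ D`, are `≤ x^{1/4}` at the
  Bombieri–Vinogradov scale `x = 2LN`);
* `eventually_junk` — `C_j + C_r N/(log N)^{t+3} ≤ N/(log N)^{t+1}`.
-/

noncomputable section

open Filter

namespace Summit.Parity.GeneralizedHardyLittlewood.Theorems.AbsoluteUpgrade

/-- Eventually `N ≥ 16` and `log N ≥ 1`. [folklore] -/
theorem eventually_basic : ∀ᶠ N : ℕ in atTop, (16 : ℝ) ≤ N ∧ 1 ≤ Real.log N := by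
  have h1 : ∀ᶠ N : ℕ in atTop, (16 : ℝ) ≤ N :=
    tendsto_natCast_atTop_atTop.eventually_ge_atTop (16 : ℝ)
  have h2 : ∀ᶠ N : ℕ in atTop, 1 ≤ Real.log N :=
    (Real.tendsto_log_atTop.comp tendsto_natCast_atTop_atTop).eventually_ge_atTop (1 : ℝ)
  exact h1.and h2

/-- Eventually `N ≥ c`. [folklore] -/
theorem eventually_ge_real (c : ℝ) : ∀ᶠ N : ℕ in atTop, c ≤ (N : ℝ) :=
  tendsto_natCast_atTop_atTop.eventually_ge_atTop c

/-- Eventually `N^e ≥ c` (`e > 0`). [folklore] -/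
theorem eventually_rpow_ge (c : ℝ) {e : ℝ} (he : 0 < e) : ∀ᶠ N : ℕ in atTop, c ≤ (N : ℝ) ^ e :=
  ((tendsto_rpow_atTop he).comp tendsto_natCast_atTop_atTop).eventually_ge_atTop c

/-- Eventually `log N ≥ c`. [folklore] -/
theorem eventually_log_ge (c : ℝ) : ∀ᶠ N : ℕ in atTop, c ≤ Real.log N :=
  (Real.tendsto_log_atTop.comp tendsto_natCast_atTop_atTop).eventually_ge_atTop c

/-- **The sifting level is below the level of distribution**: eventually `N^{1/17} + 1 ≤ N^{1/8}`
(`N^{1/8} = N^{1/17} N^{9/136} ≥ 2 N^{1/17}`). [folklore] -/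
theorem eventually_level : ∀ᶠ N : ℕ in atTop, (N : ℝ) ^ ((1 : ℝ) / 17) + 1 ≤ (N : ℝ) ^ ((1 : ℝ) / 8) := by
  filter_upwards [eventually_rpow_ge 2 (by norm_num : (0 : ℝ) < 9 / 136), eventually_ge_real 1]
    with N h2 hN1
  have hN0 : (0 : ℝ) ≤ N := Nat.cast_nonneg N
  have hsplit : (N : ℝ) ^ ((1 : ℝ) / 8) = (N : ℝ) ^ ((1 : ℝ) / 17) * (N : ℝ) ^ ((9 : ℝ) / 136) := by
    rw [← Real.rpow_add' hN0 (by norm_num)]; norm_num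
  have h17 : 1 ≤ (N : ℝ) ^ ((1 : ℝ) / 17) := Real.one_le_rpow hN1 (by norm_num)
  rw [hsplit]
  nlinarith

/-- **The moduli are within the Bombieri–Vinogradov range**: for `L > 0`, eventually
`L N^{1/8} ≤ (2LN)^{1/4}` (`(L^4 N^{1/2})^{1/4} = L N^{1/8}` and `L^4 N^{1/2} ≤ 2LN` once
`N^{1/2} ≥ L³`). [folklore] -/
theorem eventually_quarter {L : ℝ} (hL : 0 < L) :
    ∀ᶠ N : ℕ in atTop, L * (N : ℝ) ^ ((1 : ℝ) / 8) ≤ (2 * L * N) ^ ((1 : ℝ) / 4) := by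
  filter_upwards [eventually_rpow_ge (L ^ 3) (by norm_num : (0 : ℝ) < 1 / 2), eventually_ge_real 1]
    with N hN hN1
  have hN0 : (0 : ℝ) < N := by linarith
  have h1 : L * (N : ℝ) ^ ((1 : ℝ) / 8) = (L ^ 4 * (N : ℝ) ^ ((1 : ℝ) / 2)) ^ ((1 : ℝ) / 4) := by
    rw [Real.mul_rpow (by positivity) (by positivity), ← Real.rpow_mul hN0.le]
    have hL4 : (L ^ 4) ^ ((1 : ℝ) / 4) = L := by
      rw [show (L ^ 4) = L ^ ((4 : ℕ) : ℝ) by rw [Real.rpow_natCast], ← Real.rpow_mul hL.le]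
      norm_num
    rw [hL4]
    norm_num
  rw [h1]
  refine Real.rpow_le_rpow (by positivity) ?_ (by norm_num)
  -- `L^4 N^{1/2} ≤ 2 L N` from `L^3 ≤ N^{1/2}` and `N^{1/2} N^{1/2} = N`
  have hsq : (N : ℝ) ^ ((1 : ℝ) / 2) * (N : ℝ) ^ ((1 : ℝ) / 2) = N := by
    rw [← Real.rpow_add hN0]; norm_num
  have hh0 : 0 ≤ (N : ℝ) ^ ((1 : ℝ) / 2) := by positivity
  calc L ^ 4 * (N : ℝ) ^ ((1 : ℝ) / 2) = L * (L ^ 3 * (N : ℝ) ^ ((1 : ℝ) / 2)) := by ring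
    _ ≤ L * ((N : ℝ) ^ ((1 : ℝ) / 2) * (N : ℝ) ^ ((1 : ℝ) / 2)) :=
        mul_le_mul_of_nonneg_left (mul_le_mul_of_nonneg_right hN hh0) hL.le
    _ = L * N := by rw [hsq]
    _ ≤ 2 * L * N := by nlinarith

/-- **Absorbing the junk terms**: eventually `C_j + C_r N/(log N)^{t+3} ≤ N/(log N)^{t+1}`
(`(log N)^{t+2} ≤ N` and `log N ≥ max(1, 2C_j, 2C_r)`). [folklore] -/
theorem eventually_junk : ∀ (t : ℕ) (Cj Cr : ℝ), ∀ᶠ N : ℕ in atTop, Cj + Cr * N / Real.log N ^ (t + 3) ≤ (N : ℝ) / Real.log N ^ (t + 1) := by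
  intro t Cj Cr
  obtain ⟨N₂, hN₂⟩ := Literature.NumberTheory.Sieve.RoughTuple.exists_pow_log_le (t + 2)
  filter_upwards [eventually_ge_atTop N₂, eventually_log_ge (max 1 (max (2 * Cj) (2 * Cr))),
    eventually_ge_real 1] with N hN hlog hN1
  have hlog1 : 1 ≤ Real.log N := le_trans (le_max_left _ _) hlog
  have hlogj : 2 * Cj ≤ Real.log N := le_trans ((le_max_left _ _).trans (le_max_right _ _)) hlog
  have hlogr : 2 * Cr ≤ Real.log N := le_trans ((le_max_right _ _).trans (le_max_right _ _)) hlog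
  have hpow := hN₂ N hN
  set Lg := Real.log N with hLg
  have hL0 : 0 < Lg := by linarith
  have hN0 : (0 : ℝ) < N := by linarith
  have hLt1 : 0 < Lg ^ (t + 1) := pow_pos hL0 _
  -- `Cj ≤ N / (2 Lg^{t+1})`: `2 Cj Lg^{t+1} ≤ Lg · Lg^{t+1} = Lg^{t+2} ≤ N`
  have hj : Cj * Lg ^ (t + 1) ≤ N / 2 := by
    have h1 : 2 * Cj * Lg ^ (t + 1) ≤ Lg * Lg ^ (t + 1) :=
      mul_le_mul_of_nonneg_right hlogj hLt1.le
    have h2 : Lg * Lg ^ (t + 1) = Lg ^ (t + 2) := by ring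
    linarith
  -- `Cr N / Lg^{t+3} ≤ N/(2 Lg^{t+1})`: `2 Cr ≤ Lg ≤ Lg^2`
  have hr : Cr * N / Lg ^ (t + 3) * Lg ^ (t + 1) ≤ N / 2 := by
    have hL2 : Lg ≤ Lg ^ 2 := by nlinarith
    have hCrL : 2 * Cr ≤ Lg ^ 2 := hlogr.trans hL2
    have e : Cr * N / Lg ^ (t + 3) * Lg ^ (t + 1) = Cr * N / Lg ^ 2 := by
      field_simp; ring
    rw [e, div_le_div_iff₀ (by positivity) (by norm_num : (0 : ℝ) < 2)]
    nlinarith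
  rw [le_div_iff₀ hLt1, add_mul]
  linarith

end Summit.Parity.GeneralizedHardyLittlewood.Theorems.AbsoluteUpgrade

end
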